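import Summits.BirchSwinnertonDyer.BirchSwinnertonDyer.Theorems.ByReductionTypeAtTwoSupersingularFlatBlindCardTransport
import Summits.BirchSwinnertonDyer.BirchSwinnertonDyer.Theorems.ByReductionTypeAtTwoSupersingularFlatBlindTwistCurveSide
import Summits.BirchSwinnertonDyer.BirchSwinnertonDyer.Theorems.ByReductionTypeAtTwoSupersingularFlatBlindTwistSideStrictCount
import Summits.BirchSwinnertonDyer.BirchSwinnertonDyer.Theorems.ByReductionTypeAtTwoSupersingularFlatBlindTwistSideKummerLine
import Summits.BirchSwinnertonDyer.Rank1Residual.F1Sign2.HondaSystemAtTwo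
import Literature.NumberTheory.EllipticCurves.PadicFormalLogOrder
import Literature.NumberTheory.EllipticCurves.TamagawaFiniteIndexProofs
import HarnessLib

/-!
# Route `ByReductionTypeAtTwo` (rung K4), crux `SupersingularRankZeroAtTwo` (item stmt-BirchSwinnertonDyer-19097), line
# `odd_blind_package` (registry v2.10.1), slot 5 `stub_CD` = CDC_H `OddBlindPackage.FlatBlindControlCardHondaAtTwo`:
# **THE CDC_H GLUE — CDC_H from three NAMED W₂-side binders (dictionary, Tamagawa splitting, position) and one index binder,
# with every other input a tree theorem BY NAME** (cell `bsd-2adic`, LEAD ss-1 GEN 21; memo `HOME/ss/gen21/HAND-TARGETS-CDC-2.md`)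

HONEST FRAMING: THEOREMS ONLY (no definition, no named fact, no `sorry`, no instance); a helper
(`--supports stmt-BirchSwinnertonDyer-19097`). It does NOT prove CDC_H: it REDUCES it. The conclusion of
`flatBlindControlCardHondaAtTwo_of` is the body of `OddBlindPackage.FlatBlindControlCardHondaAtTwo` (v2.10.1 :821–856) VERBATIM; its four
hypotheses are the remaining debt, each a ∀-statement over tree objects to be landed as its own theorem and then fed here by `exact`:
(B1) the twist DICTIONARY (∃ intertwiners `φ/ψ : W₂[2^J] ⇄ E[2^J](χ₋₁)` transporting the exact E-side local conditions off `v` to the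
W₂-Kummer conditions — at `∞` the Kummer condition, at odd `ℓ` «dies in `H¹((ℚ_∞)_w, W₂)`» — and carrying the W₂-Kummer line at `v`
into the twisted Kummer line, tower-1 ★ p811113's clause); (B2) TAMAGAWA SPLITTING at a large finite level (`#H¹_𝓑 · 2^{v₂ c₂(W₂)} =
#H¹_𝓑' · 2^{v₂ Tam(W₂)}`, `𝓑` the transported exact structure, `𝓑'` = the transported ♭-line at `v` + W₂-Kummer elsewhere; hands HT-C3 /
HT-C4(c) + Poitou–Tate count); (B3) POSITION (`#H¹_𝓑' = #S⁰ · 2^{ι(P₁)}` for the normalised `λ` and a generator `P₁`; hands HT-C4(a)(b) +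
Poitou–Tate + HT-C2's currency); (B5) the rank-one INDEX bookkeeping `padicLogOrd W₂ 2 ι P − v₂[W₂(ℚ):ℤP] = v₂ λ(P₁)`. Discharged BY NAME
inside: `T = T[2^J]` and the transport `#T[2^J] = #H¹_𝓑` (★ p813776), the strict count HT-C2 (★★ p812748), `c₂(W₂) = 1` (★★ p813944), the
normalised `λ = log_ω` on `W₂(ℚ₂)` (★ p814209). Nothing booked; 19097 stays OPEN; BSD is proved for no curve by any of this.
bears_on: K4 (19097).

References: [GreenbergLNM1716] §3–§4; [MilneADT2006] I Thm. 4.10; [Sprung2012] Def. 7.9/7.11, Thm. 2.2; [SilvermanAEC2009] VII.6, VIII.6;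
[BarriosEtAl2025] Thm. 5.1.
-/

set_option autoImplicit false
set_option linter.dupNamespace false

noncomputable section

open scoped Classical NumberField AddSubgroup ContRepresentation

namespace Summit.BirchSwinnertonDyer.BirchSwinnertonDyer.Theorems

namespace OddBlindLocal

open NumberField IsDedekindDomain Field WeierstrassCurve Literature.NumberTheory.EllipticCurves
  Literature.NumberTheory.EllipticCurves.IwasawaDual Literature.NumberTheory.GaloisRepresentations
  Literature.NumberTheory.GaloisCohomology ZpExtension Literature.NumberTheory.EllipticCurves.Kobayashi2003
  Literature.NumberTheory.EllipticCurves.Sprung2017 Literature.NumberTheory.EllipticCurves.Sprung2012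
  Literature.NumberTheory.EllipticCurves.Rank1Residual Summit.BirchSwinnertonDyer.Rank1Residual.Additive
open Literature.NumberTheory.GaloisRepresentations.DiscreteGaloisModule (SelmerStructure)

/-- `P ∈ W(K)` of infinite order stays of infinite order in `W(ℚ_p)` along any embedding (injective group hom). [folklore] -/
theorem not_isOfFinAddOrder_padicPointOf_of_not (W : WeierstrassCurve ℚ) (p : ℕ) [Fact p.Prime]
    (ι : ℚ →+* ℚ_[p]) (P : (W.baseChange ℚ).toAffine.Point) (hP : ¬ IsOfFinAddOrder P) :
    ¬ IsOfFinAddOrder (Literature.NumberTheory.EllipticCurves.padicPointOf W p ι P) := by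
  intro h
  apply hP
  obtain ⟨n, hn, hnP⟩ := (isOfFinAddOrder_iff_nsmul_eq_zero).mp h
  refine (isOfFinAddOrder_iff_nsmul_eq_zero).mpr ⟨n, hn, ?_⟩
  apply WeierstrassCurve.Affine.Point.map_injective (f := ι.toRatAlgHom)
  rw [map_nsmul, map_zero]
  exact hnP

/-- ★★ **THE CDC_H GLUE.** `OddBlindPackage.FlatBlindControlCardHondaAtTwo` (its body VERBATIM as the conclusion) FROM: (B1) the twist dictionary,
(B2) the Tamagawa splitting count, (B3) the position count, (B5) the rank-one index bookkeeping — each a named ∀-binder — with `T = T[2^J]`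
(`exists_forall_natCard_torsionBy_endInvariants_eq`), the transport `#T[2^J] = #H¹_𝓑(ℚ, W₂[2^J])` (`natCard_torsionBy_endInvariants_eq_natCard_selmerGroup_transport`,
built on HT-C1 ★ p812879), the strict count HT-C2 (`FlatBlindTwistSide.HTC2_natCard_strictSelmer_eq`, ★★ p812748), the curve constant
`c₂(W₂) = 1` (`localTamagawaNumber_twist_two_of_goodSS`, ★★ p813944) and the normalised `λ = log_ω` (`exists_normalized_functional_twist_of_goodSS`,
★ p814209) fed BY NAME. ASSEMBLY: `v₂#T = v₂#H¹_𝓑 = v₂#H¹_𝓑' + v₂Tam(W₂) − v₂c₂(W₂) = v₂#S⁰ + ι + v₂Tam = v₂#Ш + 2ι + v₂Tam`, and the right-hand side is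
`v₂#Ш + v₂Tam + 2(padicLogOrd − v₂ idx) = v₂#Ш + v₂Tam + 2ι` by (B5). HONEST: a REDUCTION, not a proof — (B1)(B2)(B3) are the Poitou–Tate content
(their provers use the cell's print binder `poitouTate_selmerStructure_duality_real ℚ`, Milne ADT I.4.10, and hands HT-C3/HT-C4), (B5) is bookkeeping;
19097 stays OPEN; BSD is proved for no curve. [cite: GreenbergLNM1716, §3 Lemma 3.3 and §4 pp. 122–124] [cite: MilneADT2006, I Thm. 4.10]
[cite: Sprung2012, Def. 7.9, Def. 7.11, Thm. 2.2] [cite: SilvermanAEC2009, VII.6.3, VIII.6.7] -/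
theorem flatBlindControlCardHondaAtTwo_of
    (hB1 : ∀ (W : WeierstrassCurve ℚ) [W.IsElliptic] [W.IsGloballyMinimal], GoodSS W 2 →
      ∀ (κ : ZpExtension ℚ 2), κ.IsCyclotomic →
      ∀ (v : HeightOneSpectrum (𝓞 ℚ)), (2 : 𝓞 ℚ) ∈ v.asIdeal →
      ∀ (g : Field.absoluteGaloisGroup (v.adicCompletion ℚ)) (c : ℕ → localPoints W (v.adicCompletion ℚ)),
        κ.IsTopGenerator (resGalOfEmb (closureEmb (K := ℚ) (v.adicCompletion ℚ)) g) →
      ∀ (W₂ : WeierstrassCurve ℚ) [W₂.IsElliptic] [W₂.IsGloballyMinimal],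
        (∃ C : WeierstrassCurve.VariableChange ℚ, C • W.quadraticTwist 2 = W₂) →
      ∀ J : ℕ, ∃ (φ : (W₂.torsionGaloisModule ((2 ^ J : ℕ) : ℤ)).toContRepresentation →ⁱL
          (W.twistedTorsionGaloisModule 2 κ J (-1) OddBlindTwist.two_dvd_neg_one_sub_one).toContRepresentation)
        (ψ : (W.twistedTorsionGaloisModule 2 κ J (-1) OddBlindTwist.two_dvd_neg_one_sub_one).toContRepresentation →ⁱL
          (W₂.torsionGaloisModule ((2 ^ J : ℕ) : ℤ)).toContRepresentation),
        (∀ a, ψ (φ a) = a) ∧ (∀ b, φ (ψ b) = b) ∧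
        (∀ w : InfinitePlace ℚ, ((W.twistedTorsionToLocalH1 2 κ J (-1) OddBlindTwist.two_dvd_neg_one_sub_one w.Completion).ker).map
            (galoisCohomology.map (ψ.restrictField w.Completion) 1) =
          W₂.kummerLocalConditionAt ((2 ^ J : ℕ) : ℤ) w.Completion) ∧
        (∀ v' : HeightOneSpectrum (𝓞 ℚ), v' ≠ v →
          (W.twistedSharpFlatLocalFamily 2 κ J (-1) OddBlindTwist.two_dvd_neg_one_sub_one v
              (localTowerPointsOfEmb κ (closureEmb (K := ℚ) (v.adicCompletion ℚ)) W)
              (colemanKer κ (closureEmb (K := ℚ) (v.adicCompletion ℚ)) W (W.frobeniusTrace 2) g c .flat) v').map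
            (galoisCohomology.map (ψ.restrictField (v'.adicCompletion ℚ)) 1) =
          ((resH1Hom (Literature.NumberTheory.EllipticCurves.subgroupIncl (localSubgroup κ.kerSubgroup (v'.adicCompletion ℚ)))
              (AddMonoidHom.id (localPoints W₂ (v'.adicCompletion ℚ))) (fun _ _ ↦ rfl)).ker).comap
            (galoisCohomology.map (W₂.torsionPointsMapIntertwining ((2 ^ J : ℕ) : ℤ) (v'.adicCompletion ℚ)) 1)) ∧
        (W₂.kummerLocalConditionAt ((2 ^ J : ℕ) : ℤ) (v.adicCompletion ℚ)).map
            (galoisCohomology.map (φ.restrictField (v.adicCompletion ℚ)) 1) ≤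
          W.twistedTorsionLocalKummer 2 κ J (-1) OddBlindTwist.two_dvd_neg_one_sub_one (v.adicCompletion ℚ)
            (localLayerPointsOfEmb κ (closureEmb (K := ℚ) (v.adicCompletion ℚ)) W 1 ⊓
              (DistribSMul.toAddMonoidHom (localPoints W (v.adicCompletion ℚ)) g + AddMonoidHom.id _).ker))
    (hB2 : ∀ (W : WeierstrassCurve ℚ) [W.IsElliptic] [W.IsGloballyMinimal], GoodSS W 2 →
      ∀ (κ : ZpExtension ℚ 2) (γ : Field.absoluteGaloisGroup ℚ), κ.IsCyclotomic → κ.IsTopGenerator γ →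
      ∀ (v : HeightOneSpectrum (𝓞 ℚ)), (2 : 𝓞 ℚ) ∈ v.asIdeal →
      ∀ (g : Field.absoluteGaloisGroup (v.adicCompletion ℚ)) (c : ℕ → localPoints W (v.adicCompletion ℚ)),
        κ.IsTopGenerator (resGalOfEmb (closureEmb (K := ℚ) (v.adicCompletion ℚ)) g) →
      ∀ (W₂ : WeierstrassCurve ℚ) [W₂.IsElliptic] [W₂.IsGloballyMinimal],
        (∃ C : WeierstrassCurve.VariableChange ℚ, C • W.quadraticTwist 2 = W₂) →
        Finite (endInvariants (conjSharpFlatSelmerInfty W κ (closureEmb (K := ℚ) (v.adicCompletion ℚ))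
          (W.frobeniusTrace 2) g c .flat γ + 1)) →
      ∃ J₁ : ℕ, ∀ J : ℕ, J₁ ≤ J →
      ∀ (φ : (W₂.torsionGaloisModule ((2 ^ J : ℕ) : ℤ)).toContRepresentation →ⁱL
          (W.twistedTorsionGaloisModule 2 κ J (-1) OddBlindTwist.two_dvd_neg_one_sub_one).toContRepresentation)
        (ψ : (W.twistedTorsionGaloisModule 2 κ J (-1) OddBlindTwist.two_dvd_neg_one_sub_one).toContRepresentation →ⁱL
          (W₂.torsionGaloisModule ((2 ^ J : ℕ) : ℤ)).toContRepresentation),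
        (∀ a, ψ (φ a) = a) → (∀ b, φ (ψ b) = b) →
        (∀ w : InfinitePlace ℚ, ((W.twistedTorsionToLocalH1 2 κ J (-1) OddBlindTwist.two_dvd_neg_one_sub_one w.Completion).ker).map
            (galoisCohomology.map (ψ.restrictField w.Completion) 1) =
          W₂.kummerLocalConditionAt ((2 ^ J : ℕ) : ℤ) w.Completion) →
        (∀ v' : HeightOneSpectrum (𝓞 ℚ), v' ≠ v →
          (W.twistedSharpFlatLocalFamily 2 κ J (-1) OddBlindTwist.two_dvd_neg_one_sub_one v
              (localTowerPointsOfEmb κ (closureEmb (K := ℚ) (v.adicCompletion ℚ)) W)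
              (colemanKer κ (closureEmb (K := ℚ) (v.adicCompletion ℚ)) W (W.frobeniusTrace 2) g c .flat) v').map
            (galoisCohomology.map (ψ.restrictField (v'.adicCompletion ℚ)) 1) =
          ((resH1Hom (Literature.NumberTheory.EllipticCurves.subgroupIncl (localSubgroup κ.kerSubgroup (v'.adicCompletion ℚ)))
              (AddMonoidHom.id (localPoints W₂ (v'.adicCompletion ℚ))) (fun _ _ ↦ rfl)).ker).comap
            (galoisCohomology.map (W₂.torsionPointsMapIntertwining ((2 ^ J : ℕ) : ℤ) (v'.adicCompletion ℚ)) 1)) →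
        (W₂.kummerLocalConditionAt ((2 ^ J : ℕ) : ℤ) (v.adicCompletion ℚ)).map
            (galoisCohomology.map (φ.restrictField (v.adicCompletion ℚ)) 1) ≤
          W.twistedTorsionLocalKummer 2 κ J (-1) OddBlindTwist.two_dvd_neg_one_sub_one (v.adicCompletion ℚ)
            (localLayerPointsOfEmb κ (closureEmb (K := ℚ) (v.adicCompletion ℚ)) W 1 ⊓
              (DistribSMul.toAddMonoidHom (localPoints W (v.adicCompletion ℚ)) g + AddMonoidHom.id _).ker) →
      ∀ (𝓑 𝓑' : SelmerStructure (W₂.torsionGaloisModule ((2 ^ J : ℕ) : ℤ))),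
        (∀ w : InfinitePlace ℚ, 𝓑 (Sum.inl w) =
          ((W.twistedTorsionToLocalH1 2 κ J (-1) OddBlindTwist.two_dvd_neg_one_sub_one w.Completion).ker).map
            (galoisCohomology.map (ψ.restrictField w.Completion) 1)) →
        (∀ v' : HeightOneSpectrum (𝓞 ℚ), 𝓑 (Sum.inr v') =
          (W.twistedSharpFlatLocalFamily 2 κ J (-1) OddBlindTwist.two_dvd_neg_one_sub_one v
            (localTowerPointsOfEmb κ (closureEmb (K := ℚ) (v.adicCompletion ℚ)) W)
            (colemanKer κ (closureEmb (K := ℚ) (v.adicCompletion ℚ)) W (W.frobeniusTrace 2) g c .flat) v').map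
            (galoisCohomology.map (ψ.restrictField (v'.adicCompletion ℚ)) 1)) →
        (∀ w : InfinitePlace ℚ, 𝓑' (Sum.inl w) = W₂.kummerLocalConditionAt ((2 ^ J : ℕ) : ℤ) w.Completion) →
        (𝓑' (Sum.inr v) = (W.twistedSharpFlatLocalFamily 2 κ J (-1) OddBlindTwist.two_dvd_neg_one_sub_one v
            (localTowerPointsOfEmb κ (closureEmb (K := ℚ) (v.adicCompletion ℚ)) W)
            (colemanKer κ (closureEmb (K := ℚ) (v.adicCompletion ℚ)) W (W.frobeniusTrace 2) g c .flat) v).map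
            (galoisCohomology.map (ψ.restrictField (v.adicCompletion ℚ)) 1)) →
        (∀ v' : HeightOneSpectrum (𝓞 ℚ), v' ≠ v → 𝓑' (Sum.inr v') = W₂.kummerLocalConditionAt ((2 ^ J : ℕ) : ℤ) (v'.adicCompletion ℚ)) →
        Nat.card 𝓑.selmerGroup *
            2 ^ padicValNat 2 ((W₂.baseChange (v.adicCompletion ℚ)).localTamagawaNumber (v.adicCompletionIntegers ℚ)) =
          Nat.card 𝓑'.selmerGroup * 2 ^ padicValNat 2 W₂.tamagawaProduct)
    (hB3 : ∀ (W : WeierstrassCurve ℚ) [W.IsElliptic] [W.IsGloballyMinimal], GoodSS W 2 →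
      ∀ (κ : ZpExtension ℚ 2) (γ : Field.absoluteGaloisGroup ℚ), κ.IsCyclotomic → κ.IsTopGenerator γ →
      ∀ (v : HeightOneSpectrum (𝓞 ℚ)), (2 : 𝓞 ℚ) ∈ v.asIdeal →
      ∀ (g : Field.absoluteGaloisGroup (v.adicCompletion ℚ)) (c : ℕ → localPoints W (v.adicCompletion ℚ)),
        κ.IsTopGenerator (resGalOfEmb (closureEmb (K := ℚ) (v.adicCompletion ℚ)) g) →
        (∀ n, c n ∈ localLayerPointsOfEmb κ (closureEmb (K := ℚ) (v.adicCompletion ℚ)) W n) →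
        (∀ n, 1 ≤ n → localTraceOfEmb κ (closureEmb (K := ℚ) (v.adicCompletion ℚ)) W n (n + 1)
          (c (n + 1)) = W.frobeniusTrace 2 • c n - c (n - 1)) →
        (∀ z₀ : localLayerPointsOfEmb κ (closureEmb (K := ℚ) (v.adicCompletion ℚ)) W 0 →+ ℤ_[2],
          evalOn W (localLayerPointsOfEmb κ (closureEmb (K := ℚ) (v.adicCompletion ℚ)) W 0) z₀ (c 0) = 0 → z₀ = 0) →
        (∀ a : ℤ_[2],
          (∃ z₀ : localLayerPointsOfEmb κ (closureEmb (K := ℚ) (v.adicCompletion ℚ)) W 0 →+ ℤ_[2],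
            evalOn W (localLayerPointsOfEmb κ (closureEmb (K := ℚ) (v.adicCompletion ℚ)) W 0) z₀ (c 0) = 2 * a) →
          ∃ y : localLayerPointsOfEmb κ (closureEmb (K := ℚ) (v.adicCompletion ℚ)) W 0 →+ ℤ_[2],
            evalOn W (localLayerPointsOfEmb κ (closureEmb (K := ℚ) (v.adicCompletion ℚ)) W 0) y (c 0) = a) →
        (∃ cneg : localPoints W (v.adicCompletion ℚ),
          Summit.BirchSwinnertonDyer.Rank1Residual.F1Sign2.IsHondaSystemAtTwo κ (closureEmb (K := ℚ) (v.adicCompletion ℚ)) W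
            (W.frobeniusTrace 2) g cneg c) →
      ∀ (W₂ : WeierstrassCurve ℚ) [W₂.IsElliptic] [W₂.IsGloballyMinimal],
        (∃ C : WeierstrassCurve.VariableChange ℚ, C • W.quadraticTwist 2 = W₂) →
        W₂.mordellWeilRank = 1 → Finite (AddCommGroup.primaryComponent W₂.sha 2) →
        Finite (endInvariants (conjSharpFlatSelmerInfty W κ (closureEmb (K := ℚ) (v.adicCompletion ℚ))
          (W.frobeniusTrace 2) g c .flat γ + 1)) →
      ∃ J₂ : ℕ, ∀ J : ℕ, J₂ ≤ J →
      ∀ (φ : (W₂.torsionGaloisModule ((2 ^ J : ℕ) : ℤ)).toContRepresentation →ⁱL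
          (W.twistedTorsionGaloisModule 2 κ J (-1) OddBlindTwist.two_dvd_neg_one_sub_one).toContRepresentation)
        (ψ : (W.twistedTorsionGaloisModule 2 κ J (-1) OddBlindTwist.two_dvd_neg_one_sub_one).toContRepresentation →ⁱL
          (W₂.torsionGaloisModule ((2 ^ J : ℕ) : ℤ)).toContRepresentation),
        (∀ a, ψ (φ a) = a) → (∀ b, φ (ψ b) = b) →
        (∀ w : InfinitePlace ℚ, ((W.twistedTorsionToLocalH1 2 κ J (-1) OddBlindTwist.two_dvd_neg_one_sub_one w.Completion).ker).map
            (galoisCohomology.map (ψ.restrictField w.Completion) 1) =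
          W₂.kummerLocalConditionAt ((2 ^ J : ℕ) : ℤ) w.Completion) →
        (∀ v' : HeightOneSpectrum (𝓞 ℚ), v' ≠ v →
          (W.twistedSharpFlatLocalFamily 2 κ J (-1) OddBlindTwist.two_dvd_neg_one_sub_one v
              (localTowerPointsOfEmb κ (closureEmb (K := ℚ) (v.adicCompletion ℚ)) W)
              (colemanKer κ (closureEmb (K := ℚ) (v.adicCompletion ℚ)) W (W.frobeniusTrace 2) g c .flat) v').map
            (galoisCohomology.map (ψ.restrictField (v'.adicCompletion ℚ)) 1) =
          ((resH1Hom (Literature.NumberTheory.EllipticCurves.subgroupIncl (localSubgroup κ.kerSubgroup (v'.adicCompletion ℚ)))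
              (AddMonoidHom.id (localPoints W₂ (v'.adicCompletion ℚ))) (fun _ _ ↦ rfl)).ker).comap
            (galoisCohomology.map (W₂.torsionPointsMapIntertwining ((2 ^ J : ℕ) : ℤ) (v'.adicCompletion ℚ)) 1)) →
        (W₂.kummerLocalConditionAt ((2 ^ J : ℕ) : ℤ) (v.adicCompletion ℚ)).map
            (galoisCohomology.map (φ.restrictField (v.adicCompletion ℚ)) 1) ≤
          W.twistedTorsionLocalKummer 2 κ J (-1) OddBlindTwist.two_dvd_neg_one_sub_one (v.adicCompletion ℚ)
            (localLayerPointsOfEmb κ (closureEmb (K := ℚ) (v.adicCompletion ℚ)) W 1 ⊓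
              (DistribSMul.toAddMonoidHom (localPoints W (v.adicCompletion ℚ)) g + AddMonoidHom.id _).ker) →
      ∀ (𝓑' : SelmerStructure (W₂.torsionGaloisModule ((2 ^ J : ℕ) : ℤ))),
        (∀ w : InfinitePlace ℚ, 𝓑' (Sum.inl w) = W₂.kummerLocalConditionAt ((2 ^ J : ℕ) : ℤ) w.Completion) →
        (𝓑' (Sum.inr v) = (W.twistedSharpFlatLocalFamily 2 κ J (-1) OddBlindTwist.two_dvd_neg_one_sub_one v
            (localTowerPointsOfEmb κ (closureEmb (K := ℚ) (v.adicCompletion ℚ)) W)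
            (colemanKer κ (closureEmb (K := ℚ) (v.adicCompletion ℚ)) W (W.frobeniusTrace 2) g c .flat) v).map
            (galoisCohomology.map (ψ.restrictField (v.adicCompletion ℚ)) 1)) →
        (∀ v' : HeightOneSpectrum (𝓞 ℚ), v' ≠ v → 𝓑' (Sum.inr v') = W₂.kummerLocalConditionAt ((2 ^ J : ℕ) : ℤ) (v'.adicCompletion ℚ)) →
      ∀ (lam : (W₂.baseChange ℚ_[2]).toAffine.Point →+ ℤ_[2]), (∀ X, lam X = 0 ↔ IsOfFinAddOrder X) → Function.Surjective lam →
      ∀ (P₁ : W₂.toAffine.Point), (∀ P : W₂.toAffine.Point, ∃ (a : ℤ) (t : W₂.toAffine.Point), IsOfFinAddOrder t ∧ P = a • P₁ + t) →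
        Nat.card 𝓑'.selmerGroup =
          Nat.card ↥(W₂.selmerGroupPInfty 2 ⊓ selmerLocalKerPrimaryTorsion W₂ ℚ_[2] 2) *
            2 ^ (lam (Affine.Point.baseChange (W' := W₂) ℚ ℚ_[2] P₁)).valuation)
    (hB5 : ∀ (W : WeierstrassCurve ℚ) [W.IsElliptic] [W.IsGloballyMinimal], GoodSS W 2 →
      ∀ (W₂ : WeierstrassCurve ℚ) [W₂.IsElliptic] [W₂.IsGloballyMinimal],
        (∃ C : WeierstrassCurve.VariableChange ℚ, C • W.quadraticTwist 2 = W₂) → W₂.mordellWeilRank = 1 →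
      ∀ (lam : (W₂.baseChange ℚ_[2]).toAffine.Point →+ ℤ_[2]), (∀ X, lam X = 0 ↔ IsOfFinAddOrder X) →
      ∀ (P₁ : W₂.toAffine.Point), (∀ P : W₂.toAffine.Point, ∃ (a : ℤ) (t : W₂.toAffine.Point), IsOfFinAddOrder t ∧ P = a • P₁ + t) →
      ∀ (ι : ℚ →+* ℚ_[2]) (P : (W₂.baseChange ℚ).toAffine.Point), ¬ IsOfFinAddOrder P →
        (((lam (Literature.NumberTheory.EllipticCurves.padicPointOf W₂ 2 ι P) : ℤ_[2]) : ℚ_[2]).valuation - (padicValNat 2 (AddSubgroup.zmultiples P).index : ℤ)) =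
          ((lam (Affine.Point.baseChange (W' := W₂) ℚ ℚ_[2] P₁)).valuation : ℤ)) :
    ∀ (W : WeierstrassCurve ℚ) [W.IsElliptic] [W.IsGloballyMinimal],
    ¬ W.HasCM → GoodSS W 2 → W.rootNumber * ZMod.χ₈ (W.conductorNorm ℤ : ZMod 8) = -1 →
    ∀ (κ : ZpExtension ℚ 2) (γ : Field.absoluteGaloisGroup ℚ),
      κ.IsCyclotomic → κ.IsTopGenerator γ → IsCyclotomicVariable 2 γ →
    ∀ (v : HeightOneSpectrum (𝓞 ℚ)), (2 : 𝓞 ℚ) ∈ v.asIdeal →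
    ∀ (g : Field.absoluteGaloisGroup (v.adicCompletion ℚ)) (c : ℕ → localPoints W (v.adicCompletion ℚ)),
      κ.IsTopGenerator (resGalOfEmb (closureEmb (K := ℚ) (v.adicCompletion ℚ)) g) →
      (∀ n, c n ∈ localLayerPointsOfEmb κ (closureEmb (K := ℚ) (v.adicCompletion ℚ)) W n) →
      (∀ n, 1 ≤ n → localTraceOfEmb κ (closureEmb (K := ℚ) (v.adicCompletion ℚ)) W n (n + 1)
        (c (n + 1)) = W.frobeniusTrace 2 • c n - c (n - 1)) →
      (∀ z₀ : localLayerPointsOfEmb κ (closureEmb (K := ℚ) (v.adicCompletion ℚ)) W 0 →+ ℤ_[2],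
        evalOn W (localLayerPointsOfEmb κ (closureEmb (K := ℚ) (v.adicCompletion ℚ)) W 0) z₀ (c 0) = 0 →
          z₀ = 0) →
      (∀ a : ℤ_[2],
        (∃ z₀ : localLayerPointsOfEmb κ (closureEmb (K := ℚ) (v.adicCompletion ℚ)) W 0 →+ ℤ_[2],
          evalOn W (localLayerPointsOfEmb κ (closureEmb (K := ℚ) (v.adicCompletion ℚ)) W 0) z₀ (c 0) = 2 * a) →
        ∃ y : localLayerPointsOfEmb κ (closureEmb (K := ℚ) (v.adicCompletion ℚ)) W 0 →+ ℤ_[2],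
          evalOn W (localLayerPointsOfEmb κ (closureEmb (K := ℚ) (v.adicCompletion ℚ)) W 0) y (c 0) = a) →
      (∃ cneg : localPoints W (v.adicCompletion ℚ),
        Summit.BirchSwinnertonDyer.Rank1Residual.F1Sign2.IsHondaSystemAtTwo κ (closureEmb (K := ℚ) (v.adicCompletion ℚ)) W
          (W.frobeniusTrace 2) g cneg c) →
    ∀ (W₂ : WeierstrassCurve ℚ) [W₂.IsElliptic] [W₂.IsGloballyMinimal],
      (∃ C : WeierstrassCurve.VariableChange ℚ, C • W.quadraticTwist 2 = W₂) →
      W₂.mordellWeilRank = 1 → Finite (AddCommGroup.primaryComponent W₂.sha 2) →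
    ∀ (ι : ℚ →+* ℚ_[2]) (P : (W₂.baseChange ℚ).toAffine.Point), ¬ IsOfFinAddOrder P →
      Finite (endInvariants (conjSharpFlatSelmerInfty W κ (closureEmb (K := ℚ) (v.adicCompletion ℚ))
        (W.frobeniusTrace 2) g c .flat γ + 1)) →
      (padicValNat 2 (Nat.card (endInvariants (conjSharpFlatSelmerInfty W κ
          (closureEmb (K := ℚ) (v.adicCompletion ℚ)) (W.frobeniusTrace 2) g c .flat γ + 1))) : ℤ) =
        (padicValNat 2 (Nat.card (AddCommGroup.primaryComponent W₂.sha 2)) : ℤ) +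
          (padicValNat 2 W₂.tamagawaProduct : ℤ) +
          2 * (Literature.NumberTheory.EllipticCurves.padicLogOrd W₂ 2 ι P -
            (padicValNat 2 (AddSubgroup.zmultiples P).index : ℤ)) := by
  intro W _ _ _hCM hss _hodd κ γ hκ hγ _hcv v hv g c hg hc htr hz hsat hHonda W₂ _ _ htw hr hsha ι P hP hfin
  haveI := hfin
  haveI := hsha
  -- the level: `T = T[2^J]` for `J ≥ J₀`, Tamagawa for `J ≥ J₁`, position for `J ≥ J₂`
  obtain ⟨J₀, hJ₀⟩ := exists_forall_natCard_torsionBy_endInvariants_eq W κ γ v g c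
  obtain ⟨J₁, hJ₁⟩ := hB2 W hss κ γ hκ hγ v hv g c hg W₂ htw hfin
  obtain ⟨J₂, hJ₂⟩ := hB3 W hss κ γ hκ hγ v hv g c hg hc htr hz hsat hHonda W₂ htw hr hsha hfin
  set J := J₀ + J₁ + J₂ with hJ
  -- the dictionary at level `J`
  obtain ⟨φ, ψ, hψφ, hφψ, hDinl, hDinr, hDv⟩ := hB1 W hss κ hκ v hv g c hg W₂ htw J
  -- the two W₂-side structures, as literals
  let 𝓑 : SelmerStructure (W₂.torsionGaloisModule ((2 ^ J : ℕ) : ℤ)) := fun pl ↦ match pl with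
    | Sum.inl w => ((W.twistedTorsionToLocalH1 2 κ J (-1) OddBlindTwist.two_dvd_neg_one_sub_one w.Completion).ker).map
        (galoisCohomology.map (ψ.restrictField w.Completion) 1)
    | Sum.inr v' => (W.twistedSharpFlatLocalFamily 2 κ J (-1) OddBlindTwist.two_dvd_neg_one_sub_one v
        (localTowerPointsOfEmb κ (closureEmb (K := ℚ) (v.adicCompletion ℚ)) W)
        (colemanKer κ (closureEmb (K := ℚ) (v.adicCompletion ℚ)) W (W.frobeniusTrace 2) g c .flat) v').map
        (galoisCohomology.map (ψ.restrictField (v'.adicCompletion ℚ)) 1)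
  let 𝓑' : SelmerStructure (W₂.torsionGaloisModule ((2 ^ J : ℕ) : ℤ)) :=
    Function.update (W₂.kummerSelmerStructure ((2 ^ J : ℕ) : ℤ)) (Sum.inr v)
      ((W.twistedSharpFlatLocalFamily 2 κ J (-1) OddBlindTwist.two_dvd_neg_one_sub_one v
        (localTowerPointsOfEmb κ (closureEmb (K := ℚ) (v.adicCompletion ℚ)) W)
        (colemanKer κ (closureEmb (K := ℚ) (v.adicCompletion ℚ)) W (W.frobeniusTrace 2) g c .flat) v).map
        (galoisCohomology.map (ψ.restrictField (v.adicCompletion ℚ)) 1))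
  have h𝓑'inl : ∀ w : InfinitePlace ℚ, 𝓑' (Sum.inl w) = W₂.kummerLocalConditionAt ((2 ^ J : ℕ) : ℤ) w.Completion := fun w ↦ by
    have hne : (Sum.inl w : Place ℚ) ≠ Sum.inr v := Sum.inl_ne_inr
    simp only [𝓑', Function.update_of_ne hne]
    rfl
  have h𝓑'v : 𝓑' (Sum.inr v) = (W.twistedSharpFlatLocalFamily 2 κ J (-1) OddBlindTwist.two_dvd_neg_one_sub_one v
      (localTowerPointsOfEmb κ (closureEmb (K := ℚ) (v.adicCompletion ℚ)) W)
      (colemanKer κ (closureEmb (K := ℚ) (v.adicCompletion ℚ)) W (W.frobeniusTrace 2) g c .flat) v).map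
      (galoisCohomology.map (ψ.restrictField (v.adicCompletion ℚ)) 1) :=
    Function.update_self _ _ _
  have h𝓑'inr : ∀ v' : HeightOneSpectrum (𝓞 ℚ), v' ≠ v →
      𝓑' (Sum.inr v') = W₂.kummerLocalConditionAt ((2 ^ J : ℕ) : ℤ) (v'.adicCompletion ℚ) := fun v' hv' ↦ by
    have hne : (Sum.inr v' : Place ℚ) ≠ Sum.inr v := fun h ↦ hv' (Sum.inr_injective h)
    simp only [𝓑', Function.update_of_ne hne]
    rfl
  -- step 1–3: `#T = #T[2^J] = #H¹_𝓑`
  have h1 : Nat.card (endInvariants (conjSharpFlatSelmerInfty W κ (closureEmb (K := ℚ) (v.adicCompletion ℚ))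
      (W.frobeniusTrace 2) g c .flat γ + 1)) = Nat.card 𝓑.selmerGroup := by
    rw [← hJ₀ J (by omega)]
    exact natCard_torsionBy_endInvariants_eq_natCard_selmerGroup_transport W hss hκ hγ v hv g c J W₂ φ ψ hψφ hφψ 𝓑
      (fun _ ↦ rfl) (fun _ ↦ rfl)
  -- step 4: Tamagawa splitting
  have h2 := hJ₁ J (by omega) φ ψ hψφ hφψ hDinl hDinr hDv 𝓑 𝓑' (fun _ ↦ rfl) (fun _ ↦ rfl) h𝓑'inl h𝓑'v h𝓑'inr
  -- the curve constant `c₂(W₂) = 1`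
  rw [localTamagawaNumber_twist_two_of_goodSS W hss W₂ htw v hv, padicValNat_one_right, pow_zero, mul_one] at h2
  -- the normalised functional and a generator
  obtain ⟨lam, hlam, hsurj, hval⟩ := exists_normalized_functional_twist_of_goodSS W hss W₂ htw
  obtain ⟨P₁, -, hgen'⟩ := exists_generator_of_mordellWeilRank_eq_one W₂ hr
  have hgen : ∀ P : W₂.toAffine.Point, ∃ (a : ℤ) (t : W₂.toAffine.Point), IsOfFinAddOrder t ∧ P = a • P₁ + t := fun P ↦ by
    obtain ⟨a, t, ht, h⟩ := hgen' P
    exact ⟨a, t, by convert ht, by convert h⟩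
  -- step 5/7: position; step 6: the strict count HT-C2
  have h3 := hJ₂ J (by omega) φ ψ hψφ hφψ hDinl hDinr hDv 𝓑' h𝓑'inl h𝓑'v h𝓑'inr lam hlam hsurj P₁ hgen
  have h4 := FlatBlindTwistSide.HTC2_natCard_strictSelmer_eq W₂ 2 hr lam hlam hsurj P₁ hgen
  -- the index bookkeeping and the log normalisation
  have h5 := hB5 W hss W₂ htw hr lam hlam P₁ hgen ι P hP
  have hlog := padicLogOrd_eq_valuation_of_normalized W₂ ι P
    (not_isOfFinAddOrder_padicPointOf_of_not W₂ 2 ι P hP) lam hval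
  have h5' : Literature.NumberTheory.EllipticCurves.padicLogOrd W₂ 2 ι P -
      (padicValNat 2 (AddSubgroup.zmultiples P).index : ℤ) =
      ((lam (Affine.Point.baseChange (W' := W₂) ℚ ℚ_[2] P₁)).valuation : ℤ) := by
    rw [hlog]; exact h5
  -- assembly
  set ιP := (lam (Affine.Point.baseChange (W' := W₂) ℚ ℚ_[2] P₁)).valuation with hιP
  have hSha : Nat.card (AddCommGroup.primaryComponent W₂.sha 2) ≠ 0 := Nat.card_pos.ne'
  have hTam : W₂.tamagawaProduct ≠ 0 := (WeierstrassCurve.tamagawaProduct_pos_holds W₂).ne'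
  have hT : Nat.card (endInvariants (conjSharpFlatSelmerInfty W κ (closureEmb (K := ℚ) (v.adicCompletion ℚ))
      (W.frobeniusTrace 2) g c .flat γ + 1)) =
      Nat.card (AddCommGroup.primaryComponent W₂.sha 2) * 2 ^ ιP * 2 ^ ιP * 2 ^ padicValNat 2 W₂.tamagawaProduct := by
    rw [h1, h2, h3, h4]
  have hv2 : padicValNat 2 (Nat.card (endInvariants (conjSharpFlatSelmerInfty W κ (closureEmb (K := ℚ) (v.adicCompletion ℚ))
      (W.frobeniusTrace 2) g c .flat γ + 1))) =
      padicValNat 2 (Nat.card (AddCommGroup.primaryComponent W₂.sha 2)) + ιP + ιP + padicValNat 2 W₂.tamagawaProduct := by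
    haveI : Fact (Nat.Prime 2) := ⟨Nat.prime_two⟩
    rw [hT, padicValNat.mul (by positivity) (by positivity), padicValNat.mul (by positivity) (by positivity),
      padicValNat.mul hSha (by positivity), padicValNat.prime_pow, padicValNat.prime_pow]
  rw [hv2, h5']
  push_cast
  ring

end OddBlindLocal

end Summit.BirchSwinnertonDyer.BirchSwinnertonDyer.Theorems

end
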